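import Summits.ABC.IUTFork.Cor312StatementBridge
import Summits.ABC.IUTFork.Thm311LinkCompat
import Summits.ABC.IUTFork.Thm311MultiradProofs
import HarnessLib

/-!
# [IUTchIII] Cor. 3.12, check (B) in the informative form: READING R3 from Theorem 3.11 AS TYPED + two GLUING identities

Proof-only file (D-0012; abc-iut cell, D-0068 wave 5, seat abc-iut-w5-d230; director-abc ORDER 2026-08-26T00:45:37Z (3)
«GO for w5-d220's conditional kernel lemma»; the lemma and its hypotheses (b1)/(b2) are abc-iut-w5-d220's design, STATUS
2026-08-26T00:29:01Z (3)(4)). TAKES NO SIDE on [IUTchIII] Cor. 3.12 and introduces NO `Prop` fact: the gluing identities are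
INLINE HYPOTHESES of the theorems below, each with its print locator, so that the adjudication can read off exactly which
identities the typed Theorem 3.11 does NOT supply. S. Mochizuki, *Inter-universal Teichmüller theory III*, kurims manuscript
(May 2020) = `paper:url-4b091feeb646`: Thm. 3.11 (i) (Ind1)(Ind2) p. 154, (ii) (b) p. 155, (iii) (a) pp. 156–157, (c)/(d) final
clauses p. 158; Cor. 3.12 pp. 173–174; proof Step (xi-a) p. 181 l. 33–44, (xi-f)/(xi-g) p. 184 l. 19–34. [claim: Mochizuki2012, status: disputed]

THE STRUCTURAL FACT BEING PROBED (w5-d220): in the frozen typing NO clause of `FullSituation.Statement` (Thm. 3.11 (i) ∧ (ii) ∧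
(iii)) mentions the two GLUE FIELDS `Cor312.Setting.thetaRegionOf` / `qRegionOf` (Cor312Statement.lean, RESIDUALS R1/R2) over which
READING R3 — the input `∀ i v_ℚ, P.qRegion (labelSucc i) v_ℚ ∈ P.possibleImages _ v_ℚ` of abc-iut-c312-6's
`Cor312Vol.statement_of_qRegion_mem_possibleImages` — and Team B's `QFrobComparison` are stated. The only typed clause with
possible-image content is (i)'s `MultiradialCompat` / (iii)'s `EvalCompatUpToInd` (`^{n',∘}R^LGP = ^{n,∘}R^LGP`: the data of
every vertical line is a possible image of the data of every other), which speaks about the SPLITTING MONOIDS `MRData.Ψ`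
(Thm. 3.11 (i) (b)) — cf. abc-iut-c312-1's `LatticeSituation.frobPsi_mem_possibleImages`.

WHAT IS PROVED (kernel, hypotheses inline). Fix a region-forming operator `ρ` (paraphrase: splitting-monoid data at the bad
places ↦ the region it determines in each packet; print forms the Θ-pilot object from "any collection, indexed by v ∈ V^bad,
of generators up to torsion of the monoids Ψ^⊥_{F_lgp}(†𝓗𝓣^{Θ±ell NF})_v" (Def. 3.8 (i), p. 112 l. 47–50 of this seat's render)
and reads log-volumes on "[the elements of “M(−)” determined by] objects" (Prop. 3.9 (iii), p. 117 l. 36)) and assume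
* (hρ) EQUIVARIANCE of `ρ` under the indeterminacy subgroup ⟨(Ind1) ∪ (Ind2)⟩: `ρ (Φ·Ψ) = Φ '' ρ Ψ` — paraphrase: the
  region-forming algorithm is functorial in the moves of "(Ind1) the indeterminacies induced by the automorphisms of the
  procession of D^⊢-prime-strips […]" and "(Ind2) […] the indeterminacies induced by the action of independent copies of Ism"
  (Thm. 3.11 (i), p. 154 l. 52–53, l. 56–58);
* (b1) Θ-GLUE: `P.thetaRegion m = ρ ((S.col P.n).frobΨ m)` — paraphrase: the Θ-pilot region at `(n, m)` IS the region
  determined by the Kummer image of the Frobenius-like splitting monoid of `(n, m)` (Def. 3.8 (i) p. 112 + Thm. 3.11 (ii) (b)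
  p. 155);
* (b2) q-GLUE: `P.qRegion = ρ D'.Ψ` for SOME datum `D' ∈ ^{n,∘}R^LGP` — paraphrase: the q-pilot region is the region determined
  by a splitting-monoid datum that is one of the possible images of the line-`n` data; the link-faithful instance is
  `D' := S.D (n−1)` with `P.qRegion = ρ ((S.col (n−1)).frobΨ m₀)` (corollary `…_of_linkedColumn`), after Step (xi-a), p. 181
  l. 36–41: "Then the Θ×μ_LGP-link from (0,0) to (1,0) may be interpreted as a sort of gluing isomorphism that relates the
  arithmetic holomorphic structure […] at (1,0) to the arithmetic holomorphic structure at (0,0) in such a way that the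
  Θ-pilot object at (0,0) […] corresponds to the q-pilot object at (1,0)" — the link goes from the Θ-column `n−1` to the
  q-column `n`; Thm. 3.11 (iii) (a) pp. 156–157 types it as a FULL poly-isomorphism of 𝓕^⊢×μ-prime-strips.
THEN: under Thm. 3.11 (ii) (b) for column `n` (`Column.KummerB`, a conjunct of `FullSituation.Statement`) READING R3 holds at every
`(j, v_ℚ)` (`qRegion_mem_possibleImages_of_gluedMonoids`), hence — under abc-iut-c312-6's `BridgeHyps` — the printed
`Cor312.Setting.Statement` (`statement_of_thm311_of_gluedMonoids`). The membership `D' ∈ ^{n,∘}R^LGP` for `D' = S.D n'` IS the typed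
`MultiradialCompat` (or, for `n' = n ± 1`, `EvalCompatUpToInd`), so of the three inline hypotheses exactly (hρ), (b1), (b2) are NOT
supplied by the frozen Theorem 3.11 — this is the sharpened form of GAP row G-c312-11-1 / G-c312-9-1 that check (B) asks for.

A STRUCTURAL REMARK the kernel makes visible (`thetaRegion_eq_of_glue`, `thetaRegion3_eq_of_glue`): under (b1) and (ii) (b) the
Θ-region does not depend on `m`, so the (Ind3)-union `thetaRegion3 = ⋃ₘ thetaRegion m` collapses to one region — in this reading
(Ind3) plays no role and (Ind1)/(Ind2) enter only through the ONE transporting family `Φ` (cf. w5-d220 00:29:01Z (4)).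
SEQUELS in this file: §5 SHARPNESS (under the Θ-glue, R3 at a component ⟺ the q-glue (b2) there — no slack); §6 the SEMI-form in
which every gluing hypothesis is a CONTAINMENT (so (Ind3) may enlarge the Θ-regions) and the printed Statement follows via
READING R2; the data-dependent form (a region ALGORITHM functorial under the indeterminacy moves) is the companion
`Cor312GluedMonoidsFunctorial.lean`. JOINT SATISFIABILITY of {Thm. 3.11 as typed, BridgeHyps, (hρ), (b1), (b2)} (so the conditional is not about the empty set of
instances) is the companion `Cor312GluedMonoidsReading3Witness.lean` (toy level). Nothing here asserts (hρ), (b1), (b2), or takes a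
side; typed ≠ proved.
-/

noncomputable section

open Set

namespace Summit.ABC.IUTFork.Cor312Vol.GluedMonoids

open Thm311 Cor312 Literature.IUT.LogThetaLattice

variable {T : ThetaIndex}

/-! ## 1. Transport of splitting monoids along `^{n,∘}R^LGP` -/

/-- Along the class `R^LGP(D)` the splitting monoids of (b) are TRANSPORTED by one element of the indeterminacy subgroup
`⟨(Ind1) ∪ (Ind2)⟩`: if `D' ∈ R^LGP(D)` then `D'.Ψ_v = Φ·D.Ψ_v` for some `Φ` in the subgroup (abc-iut-L6-t13's
`MRData.mem_RLGP_iff`: `D' = D.map Φ`). [folklore] -/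
theorem exists_closure_psi_eq_of_mem_RLGP {L : LogShells T} {D D' : MRData L} (h : D' ∈ D.RLGP) :
    ∃ Φ ∈ Subgroup.closure (L.Ind1Family ∪ L.Ind2Family),
      ∀ (v : T.V) (hv : v ∈ T.Vbad), D'.Ψ v hv = L.starAut Φ v '' D.Ψ v hv := by
  obtain ⟨Φ, hΦ, rfl⟩ := (MRData.mem_RLGP_iff D D').1 h
  exact ⟨Φ, hΦ, fun v hv => rfl⟩

/-- The indeterminacy subgroup of abc-iut-c312-7's `Cor312.Setting` IS the subgroup `⟨(Ind1) ∪ (Ind2)⟩` of the situation's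
log-shells (same `Subgroup.closure`; also abc-iut-c312-1's `LogShells.IndGroup`). [folklore] -/
theorem indGroup_eq (S : Situation T) :
    Cor312.Setting.indGroup S = Subgroup.closure (S.L.Ind1Family ∪ S.L.Ind2Family) := rfl

/-! ## 2. The Θ-glue (b1) under Thm. 3.11 (ii) (b): the Θ-region is `m`-independent; (Ind3) collapses -/

section Glue

variable (S : LatticeSituation T) (P : Cor312.Setting S.toSituation)
  (ρ : (∀ v : T.V, v ∈ T.Vbad → Set (S.L.StarPacket v)) → ∀ (j : T.Label) (vQ : T.VQ), Set (S.L.Packet j vQ))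

/-- Under (b1) and (ii) (b) for the column `n` the Θ-pilot region at `(n, m)` is the region determined by the VERTICALLY CORIC
splitting monoid `Ψ^⊥_LGP(^{n,∘}𝓗𝓣)` — independent of `m`. [claim: Mochizuki2012, status: disputed] -/
theorem thetaRegion_eq_of_glue (hKumB : (S.col P.n).KummerB (S.D P.n))
    (hb1 : ∀ (m : ℤ) (j : T.Label) (vQ : T.VQ), P.thetaRegion m j vQ = ρ ((S.col P.n).frobΨ m) j vQ)
    (m : ℤ) (j : T.Label) (vQ : T.VQ) : P.thetaRegion m j vQ = ρ (S.D P.n).Ψ j vQ := by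
  have hΨ : (S.col P.n).frobΨ m = (S.D P.n).Ψ := funext fun v => funext fun hv => hKumB m v hv
  rw [hb1, hΨ]

/-- … hence the (Ind3)-ENLARGED region `⋃ₘ thetaRegion m` is that same region: in the reading (b1) the (Ind3)-union collapses.
[claim: Mochizuki2012, status: disputed] -/
theorem thetaRegion3_eq_of_glue (hKumB : (S.col P.n).KummerB (S.D P.n))
    (hb1 : ∀ (m : ℤ) (j : T.Label) (vQ : T.VQ), P.thetaRegion m j vQ = ρ ((S.col P.n).frobΨ m) j vQ)
    (j : T.Label) (vQ : T.VQ) : P.thetaRegion3 j vQ = ρ (S.D P.n).Ψ j vQ := by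
  show (⋃ m : ℤ, P.thetaRegion m j vQ) = _
  simp_rw [thetaRegion_eq_of_glue S P ρ hKumB hb1]
  exact Set.iUnion_const _

/-! ## 3. READING R3 from (ii) (b) + `D' ∈ ^{n,∘}R^LGP` + the two gluing identities -/

/-- **The (b1)/(b2)-conditional kernel lemma (abc-iut-w5-d220's `qRegion_mem_possibleImages_of_gluedMonoids`).** Let `ρ` be a
region-forming operator EQUIVARIANT under `⟨(Ind1) ∪ (Ind2)⟩` (hρ). If the Θ-pilot regions are glued to the Frobenius-like splitting
monoids of column `n` (b1), Thm. 3.11 (ii) (b) holds for column `n`, and the q-pilot region is glued (b2) to the splitting monoid of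
SOME datum `D' ∈ ^{n,∘}R^LGP` (a possible image of the line-`n` data), then the q-pilot region IS a possible image of the Θ-pilot
object at every `(j, v_ℚ)` — READING R3. Proof: `D'.Ψ = Φ·(^{n,∘}Ψ)` for some `Φ` in the subgroup (§1); `ρ` carries this to
`qRegion = Φ '' ρ(^{n,∘}Ψ) = Φ '' thetaRegion3` (§2). [claim: Mochizuki2012, status: disputed] -/
theorem qRegion_mem_possibleImages_of_gluedMonoids
    (hρ : ∀ Φ ∈ Subgroup.closure (S.L.Ind1Family ∪ S.L.Ind2Family),
      ∀ (Ψ : ∀ v : T.V, v ∈ T.Vbad → Set (S.L.StarPacket v)) (j : T.Label) (vQ : T.VQ),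
        ρ (fun v hv => S.L.starAut Φ v '' Ψ v hv) j vQ = Φ j vQ '' ρ Ψ j vQ)
    (hKumB : (S.col P.n).KummerB (S.D P.n))
    (hb1 : ∀ (m : ℤ) (j : T.Label) (vQ : T.VQ), P.thetaRegion m j vQ = ρ ((S.col P.n).frobΨ m) j vQ)
    {D' : MRData S.L} (hD' : D' ∈ S.RLGP P.n)
    (hb2 : ∀ (j : T.Label) (vQ : T.VQ), P.qRegion j vQ = ρ D'.Ψ j vQ) :
    ∀ (j : T.Label) (vQ : T.VQ), P.qRegion j vQ ∈ P.possibleImages j vQ := by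
  obtain ⟨Φ, hΦ, hΨ⟩ := exists_closure_psi_eq_of_mem_RLGP (L := S.L) hD'
  intro j vQ
  refine ⟨Φ, hΦ, ?_⟩
  have hD'Ψ : D'.Ψ = fun v hv => S.L.starAut Φ v '' (S.D P.n).Ψ v hv := funext fun v => funext fun hv => hΨ v hv
  rw [hb2, hD'Ψ, hρ Φ hΦ, thetaRegion3_eq_of_glue S P ρ hKumB hb1]

/-- The same with the datum of ANOTHER VERTICAL LINE `n'` as the carrier of the q-monoid: its membership `S.D n' ∈ ^{n,∘}R^LGP` is the
typed Thm. 3.11 (i) `MultiradialCompat` (abc-iut-c312-1's `Situation.mem_RLGP_of_multiradialCompat`). [claim: Mochizuki2012, status: disputed] -/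
theorem qRegion_mem_possibleImages_of_gluedMonoids_line
    (hρ : ∀ Φ ∈ Subgroup.closure (S.L.Ind1Family ∪ S.L.Ind2Family),
      ∀ (Ψ : ∀ v : T.V, v ∈ T.Vbad → Set (S.L.StarPacket v)) (j : T.Label) (vQ : T.VQ),
        ρ (fun v hv => S.L.starAut Φ v '' Ψ v hv) j vQ = Φ j vQ '' ρ Ψ j vQ)
    (hMR : S.MultiradialCompat) (hKumB : (S.col P.n).KummerB (S.D P.n))
    (hb1 : ∀ (m : ℤ) (j : T.Label) (vQ : T.VQ), P.thetaRegion m j vQ = ρ ((S.col P.n).frobΨ m) j vQ)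
    (n' : ℤ) (hb2 : ∀ (j : T.Label) (vQ : T.VQ), P.qRegion j vQ = ρ (S.D n').Ψ j vQ) :
    ∀ (j : T.Label) (vQ : T.VQ), P.qRegion j vQ ∈ P.possibleImages j vQ :=
  qRegion_mem_possibleImages_of_gluedMonoids S P ρ hρ hKumB hb1 (S.mem_RLGP_of_multiradialCompat hMR P.n n') hb2

/-- **The link-faithful instance** (Step (xi-a), p. 181 l. 33–44; Thm. 3.11 (iii) (a) pp. 156–157): the q-pilot region of column `n`
is glued to the Frobenius-like Θ-splitting monoid of the PREVIOUS column `n − 1` at some `(n−1, m₀)` — paraphrase of (xi-a)'s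
gluing (the Θ×μ_LGP-link from `(n−1, m₀)` to `(n, m₀)` makes the Θ-pilot of its domain correspond to the q-pilot of its codomain,
p. 181 l. 36–41), read at region level through `ρ` — and Thm. 3.11 (ii) (b) holds for column `n − 1` as well. Then READING R3 holds, the class identity `^{n−1,∘}R^LGP = ^{n,∘}R^LGP`
being the typed (i). [claim: Mochizuki2012, status: disputed] -/
theorem qRegion_mem_possibleImages_of_linkedColumn
    (hρ : ∀ Φ ∈ Subgroup.closure (S.L.Ind1Family ∪ S.L.Ind2Family),
      ∀ (Ψ : ∀ v : T.V, v ∈ T.Vbad → Set (S.L.StarPacket v)) (j : T.Label) (vQ : T.VQ),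
        ρ (fun v hv => S.L.starAut Φ v '' Ψ v hv) j vQ = Φ j vQ '' ρ Ψ j vQ)
    (hMR : S.MultiradialCompat) (hKumB : (S.col P.n).KummerB (S.D P.n))
    (hKumB' : (S.col (P.n - 1)).KummerB (S.D (P.n - 1)))
    (hb1 : ∀ (m : ℤ) (j : T.Label) (vQ : T.VQ), P.thetaRegion m j vQ = ρ ((S.col P.n).frobΨ m) j vQ)
    (m₀ : ℤ) (hb2 : ∀ (j : T.Label) (vQ : T.VQ), P.qRegion j vQ = ρ ((S.col (P.n - 1)).frobΨ m₀) j vQ) :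
    ∀ (j : T.Label) (vQ : T.VQ), P.qRegion j vQ ∈ P.possibleImages j vQ := by
  have hΨ : (S.col (P.n - 1)).frobΨ m₀ = (S.D (P.n - 1)).Ψ := funext fun v => funext fun hv => hKumB' m₀ v hv
  refine qRegion_mem_possibleImages_of_gluedMonoids_line S P ρ hρ hMR hKumB hb1 (P.n - 1) fun j vQ => ?_
  rw [hb2, hΨ]

end Glue

/-! ## 4. From Theorem 3.11 AS TYPED: the printed Statement of Cor. 3.12 modulo (hρ), (b1), (b2) -/

section FromThm311

variable (S : FullSituation T) (P : Cor312.Setting S.toLatticeSituation.toSituation)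
  (ρ : (∀ v : T.V, v ∈ T.Vbad → Set (S.L.StarPacket v)) → ∀ (j : T.Label) (vQ : T.VQ), Set (S.L.Packet j vQ))

/-- Theorem 3.11 as typed supplies (ii) (b) for every column. [folklore] -/
theorem kummerB_of_statement (hThm : S.Statement) (n : ℤ) : (S.col n).KummerB (S.D n) := (hThm.2.1 n).2.1

/-- Theorem 3.11 as typed supplies the multiradial compatibility `^{n,∘}R^LGP = ^{n',∘}R^LGP`. [folklore] -/
theorem multiradialCompat_of_statement (hThm : S.Statement) : S.MultiradialCompat := hThm.1.2.2

/-- **Check (B), informative form: READING R3 from THEOREM 3.11 AS TYPED plus exactly (hρ), (b1), (b2).** With `S.Statement`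
([IUTchIII] Thm. 3.11 (i) ∧ (ii) ∧ (iii) as frozen), an equivariant region-forming operator (hρ), the Θ-glue (b1) for column `n`
and the q-glue (b2) to the splitting monoid of some vertical line `n'`, the q-pilot region is a possible image of the Θ-pilot object
at every `(j, v_ℚ)`. The typed theorem contributes `KummerB` (ii)(b) and `MultiradialCompat` (i); it contributes NOTHING towards
(hρ)/(b1)/(b2), which mention `thetaRegionOf`/`qRegionOf` (absent from every clause of `Statement`, w5-d220 00:29:01Z (2)).
[claim: Mochizuki2012, status: disputed] -/
theorem reading3_of_thm311_of_gluedMonoids (hThm : S.Statement)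
    (hρ : ∀ Φ ∈ Subgroup.closure (S.L.Ind1Family ∪ S.L.Ind2Family),
      ∀ (Ψ : ∀ v : T.V, v ∈ T.Vbad → Set (S.L.StarPacket v)) (j : T.Label) (vQ : T.VQ),
        ρ (fun v hv => S.L.starAut Φ v '' Ψ v hv) j vQ = Φ j vQ '' ρ Ψ j vQ)
    (hb1 : ∀ (m : ℤ) (j : T.Label) (vQ : T.VQ), P.thetaRegion m j vQ = ρ ((S.col P.n).frobΨ m) j vQ)
    (n' : ℤ) (hb2 : ∀ (j : T.Label) (vQ : T.VQ), P.qRegion j vQ = ρ (S.D n').Ψ j vQ) :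
    ∀ (j : T.Label) (vQ : T.VQ), P.qRegion j vQ ∈ P.possibleImages j vQ :=
  qRegion_mem_possibleImages_of_gluedMonoids_line S.toLatticeSituation P ρ hρ (multiradialCompat_of_statement S hThm)
    (kummerB_of_statement S hThm P.n) hb1 n' hb2

/-- **… hence the printed Statement of Cor. 3.12** (`−|log(Θ)| ∈ ℝ` and `−|log(q)| ≤ −|log(Θ)|`) under abc-iut-c312-6's bridge
hypotheses (monotone log-volume, admissible possible images, finiteness: `BridgeHyps`), via R3 ⟹ `QIsImage` ⟹ `Cor312` ⟹ `Statement`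
(`Cor312Vol.statement_of_qRegion_mem_possibleImages`). So at the level of the frozen typing the residual of the route
from Thm. 3.11 to Cor. 3.12 is EXACTLY {(hρ), (b1), (b2)} + the bridge hypotheses — the gluing identities that tie the two pilot
regions to splitting-monoid data. Nothing is asserted about whether print supplies them. [claim: Mochizuki2012, status: disputed] -/
theorem statement_of_thm311_of_gluedMonoids (hThm : S.Statement) (H : BridgeHyps P)
    (hρ : ∀ Φ ∈ Subgroup.closure (S.L.Ind1Family ∪ S.L.Ind2Family),
      ∀ (Ψ : ∀ v : T.V, v ∈ T.Vbad → Set (S.L.StarPacket v)) (j : T.Label) (vQ : T.VQ),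
        ρ (fun v hv => S.L.starAut Φ v '' Ψ v hv) j vQ = Φ j vQ '' ρ Ψ j vQ)
    (hb1 : ∀ (m : ℤ) (j : T.Label) (vQ : T.VQ), P.thetaRegion m j vQ = ρ ((S.col P.n).frobΨ m) j vQ)
    (n' : ℤ) (hb2 : ∀ (j : T.Label) (vQ : T.VQ), P.qRegion j vQ = ρ (S.D n').Ψ j vQ) :
    P.Statement :=
  statement_of_qRegion_mem_possibleImages H fun i vQ =>
    reading3_of_thm311_of_gluedMonoids S P ρ hThm hρ hb1 n' hb2 (Setting.labelSucc i) vQ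

/-- **The link-faithful form of check (B)**: Theorem 3.11 as typed + `BridgeHyps` + (hρ) + (b1) + (paraphrase) «the q-pilot region
of column `n` is the region of the Θ-splitting monoid of column `n − 1` at `(n−1, m₀)`» (paraphrase of the Θ×μ_LGP-link gluing, Step (xi-a)
p. 181 l. 36–41) ⟹ the printed Statement of Cor. 3.12. [claim: Mochizuki2012, status: disputed] -/
theorem statement_of_thm311_of_linkedColumn (hThm : S.Statement) (H : BridgeHyps P)
    (hρ : ∀ Φ ∈ Subgroup.closure (S.L.Ind1Family ∪ S.L.Ind2Family),
      ∀ (Ψ : ∀ v : T.V, v ∈ T.Vbad → Set (S.L.StarPacket v)) (j : T.Label) (vQ : T.VQ),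
        ρ (fun v hv => S.L.starAut Φ v '' Ψ v hv) j vQ = Φ j vQ '' ρ Ψ j vQ)
    (hb1 : ∀ (m : ℤ) (j : T.Label) (vQ : T.VQ), P.thetaRegion m j vQ = ρ ((S.col P.n).frobΨ m) j vQ)
    (m₀ : ℤ) (hb2 : ∀ (j : T.Label) (vQ : T.VQ), P.qRegion j vQ = ρ ((S.col (P.n - 1)).frobΨ m₀) j vQ) :
    P.Statement :=
  statement_of_qRegion_mem_possibleImages H fun i vQ =>
    qRegion_mem_possibleImages_of_linkedColumn S.toLatticeSituation P ρ hρ (multiradialCompat_of_statement S hThm)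
      (kummerB_of_statement S hThm P.n) (kummerB_of_statement S hThm (P.n - 1)) hb1 m₀ hb2 (Setting.labelSucc i) vQ

end FromThm311

/-! ## 5. Sharpness: under the Θ-glue, READING R3 at `(j, v_ℚ)` is EQUIVALENT to the q-gluing clause (b2) there -/

section Sharpness

variable (S : LatticeSituation T) (P : Cor312.Setting S.toSituation)
  (ρ : (∀ v : T.V, v ∈ T.Vbad → Set (S.L.StarPacket v)) → ∀ (j : T.Label) (vQ : T.VQ), Set (S.L.Packet j vQ))

/-- **No slack in (b2).** Under the equivariance (hρ), the Θ-glue (b1) and Thm. 3.11 (ii) (b) for column `n`, READING R3 at a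
component `(j, v_ℚ)` holds IF AND ONLY IF the q-pilot region there is the `ρ`-region of the splitting monoid of SOME possible image
`D' ∈ ^{n,∘}R^LGP` of the line-`n` data — i.e. the q-gluing clause (b2) is not merely sufficient but is exactly what R3 says, once the
Θ-side is glued. (→: a possible image `Φ '' thetaRegion3` is `ρ` of the splitting monoid of the transported datum `(S.D n).map Φ`,
which lies in the class by abc-iut-L6-t13's `MRData.map_mem_RLGP`; ←: §3.) [claim: Mochizuki2012, status: disputed] -/
theorem qRegion_mem_possibleImages_iff_qGlue
    (hρ : ∀ Φ ∈ Subgroup.closure (S.L.Ind1Family ∪ S.L.Ind2Family),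
      ∀ (Ψ : ∀ v : T.V, v ∈ T.Vbad → Set (S.L.StarPacket v)) (j : T.Label) (vQ : T.VQ),
        ρ (fun v hv => S.L.starAut Φ v '' Ψ v hv) j vQ = Φ j vQ '' ρ Ψ j vQ)
    (hKumB : (S.col P.n).KummerB (S.D P.n))
    (hb1 : ∀ (m : ℤ) (j : T.Label) (vQ : T.VQ), P.thetaRegion m j vQ = ρ ((S.col P.n).frobΨ m) j vQ)
    (j : T.Label) (vQ : T.VQ) :
    P.qRegion j vQ ∈ P.possibleImages j vQ ↔ ∃ D' ∈ S.RLGP P.n, P.qRegion j vQ = ρ D'.Ψ j vQ := by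
  constructor
  · rintro ⟨Φ, hΦ, hq⟩
    refine ⟨(S.D P.n).map Φ, MRData.map_mem_RLGP (S.D P.n) hΦ, ?_⟩
    rw [hq, thetaRegion3_eq_of_glue S P ρ hKumB hb1]
    exact (hρ Φ hΦ (S.D P.n).Ψ j vQ).symm
  · rintro ⟨D', hD', hq⟩
    obtain ⟨Φ, hΦ, hΨ⟩ := exists_closure_psi_eq_of_mem_RLGP (L := S.L) hD'
    refine ⟨Φ, hΦ, ?_⟩
    have hD'Ψ : D'.Ψ = fun v hv => S.L.starAut Φ v '' (S.D P.n).Ψ v hv := funext fun v => funext fun hv => hΨ v hv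
    rw [hq, hD'Ψ, hρ Φ hΦ, thetaRegion3_eq_of_glue S P ρ hKumB hb1]

/-- Hence, under (hρ), (b1), (ii) (b): READING R3 at EVERY component ⟺ at every component the q-region is the `ρ`-region of the
splitting monoid of some possible image of the line-`n` data (the datum may a priori vary with the component; §3's (b2) is the
uniform case). [claim: Mochizuki2012, status: disputed] -/
theorem reading3_iff_componentwise_qGlue
    (hρ : ∀ Φ ∈ Subgroup.closure (S.L.Ind1Family ∪ S.L.Ind2Family),
      ∀ (Ψ : ∀ v : T.V, v ∈ T.Vbad → Set (S.L.StarPacket v)) (j : T.Label) (vQ : T.VQ),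
        ρ (fun v hv => S.L.starAut Φ v '' Ψ v hv) j vQ = Φ j vQ '' ρ Ψ j vQ)
    (hKumB : (S.col P.n).KummerB (S.D P.n))
    (hb1 : ∀ (m : ℤ) (j : T.Label) (vQ : T.VQ), P.thetaRegion m j vQ = ρ ((S.col P.n).frobΨ m) j vQ) :
    (∀ (j : T.Label) (vQ : T.VQ), P.qRegion j vQ ∈ P.possibleImages j vQ) ↔
      ∀ (j : T.Label) (vQ : T.VQ), ∃ D' ∈ S.RLGP P.n, P.qRegion j vQ = ρ D'.Ψ j vQ :=
  forall_congr' fun j => forall_congr' fun vQ => qRegion_mem_possibleImages_iff_qGlue S P ρ hρ hKumB hb1 j vQ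

end Sharpness

/-! ## 6. The faithful SEMI-form: containments suffice for the printed Statement (via READING R2)

This section answers note N1 of abc-iut-w5-d011's audit of p415614 (HOME/staging/w5/w5-d011/AUDIT-p415614.md): with the EQUALITY
(b1) the Θ-region is `m`-constant under (ii) (b), so (Ind3) is idle; here the Θ-glue is only the LOWER BOUND (b1⊆)
`ρ(frobΨ m) ⊆ thetaRegion m`, so the Θ-regions may vary with `m` and be enlarged by the (ii) (a) packet data exactly as print's
(Ind3) "upper semi-compatible" (p. 156 l. 33–34) allows; the price is that the conclusion is READING R2 (q-region ⊆ hull), which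
still yields the printed Statement by monotonicity of the log-volume (abc-iut-c312-6). -/

section Semi

variable (S : LatticeSituation T) (P : Cor312.Setting S.toSituation)
  (ρ : (∀ v : T.V, v ∈ T.Vbad → Set (S.L.StarPacket v)) → ∀ (j : T.Label) (vQ : T.VQ), Set (S.L.Packet j vQ))

/-- **Upper-semi form of the gluing, matching (Ind3)'s "upper semi-compatible" ([IUTchIII] Thm. 3.11 (ii), p. 156).** If the
region-forming operator is only SEMI-equivariant (hρ⊆: the region of the transported monoid lies IN the transported region), the
Θ-pilot region at `(n, m)` only CONTAINS the region of the Kummer image of the Frobenius-like splitting monoid (b1⊆ — so (Ind3) may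
enlarge the Θ-regions arbitrarily), Thm. 3.11 (ii) (b) holds for column `n`, and the q-pilot region lies IN the region of the
splitting monoid of some possible image `D' ∈ ^{n,∘}R^LGP` (b2⊆), then the q-pilot region lies in SOME possible image of the
Θ-pilot object at every `(j, v_ℚ)`. [claim: Mochizuki2012, status: disputed] -/
theorem qRegion_subset_possibleImage_of_gluedMonoids_le
    (hρ : ∀ Φ ∈ Subgroup.closure (S.L.Ind1Family ∪ S.L.Ind2Family),
      ∀ (Ψ : ∀ v : T.V, v ∈ T.Vbad → Set (S.L.StarPacket v)) (j : T.Label) (vQ : T.VQ),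
        ρ (fun v hv => S.L.starAut Φ v '' Ψ v hv) j vQ ⊆ Φ j vQ '' ρ Ψ j vQ)
    (hKumB : (S.col P.n).KummerB (S.D P.n))
    (hb1 : ∀ (m : ℤ) (j : T.Label) (vQ : T.VQ), ρ ((S.col P.n).frobΨ m) j vQ ⊆ P.thetaRegion m j vQ)
    {D' : MRData S.L} (hD' : D' ∈ S.RLGP P.n)
    (hb2 : ∀ (j : T.Label) (vQ : T.VQ), P.qRegion j vQ ⊆ ρ D'.Ψ j vQ) (j : T.Label) (vQ : T.VQ) :
    ∃ U ∈ P.possibleImages j vQ, P.qRegion j vQ ⊆ U := by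
  obtain ⟨Φ, hΦ, hΨ⟩ := exists_closure_psi_eq_of_mem_RLGP (L := S.L) hD'
  refine ⟨Φ j vQ '' P.thetaRegion3 j vQ, ⟨Φ, hΦ, rfl⟩, ?_⟩
  have hD'Ψ : D'.Ψ = fun v hv => S.L.starAut Φ v '' (S.D P.n).Ψ v hv := funext fun v => funext fun hv => hΨ v hv
  have hfrob : (S.col P.n).frobΨ 0 = (S.D P.n).Ψ := funext fun v => funext fun hv => hKumB 0 v hv
  have h0 : ρ (S.D P.n).Ψ j vQ ⊆ P.thetaRegion3 j vQ := by
    rw [← hfrob]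
    exact (hb1 0 j vQ).trans (Set.subset_iUnion (fun m : ℤ => P.thetaRegion m j vQ) 0)
  calc P.qRegion j vQ ⊆ ρ D'.Ψ j vQ := hb2 j vQ
    _ = ρ (fun v hv => S.L.starAut Φ v '' (S.D P.n).Ψ v hv) j vQ := by rw [hD'Ψ]
    _ ⊆ Φ j vQ '' ρ (S.D P.n).Ψ j vQ := hρ Φ hΦ _ j vQ
    _ ⊆ Φ j vQ '' P.thetaRegion3 j vQ := Set.image_mono h0

/-- … hence the q-pilot region lies in the holomorphic hull `^{n,∘}𝒰_{j,v_ℚ}` of the union of the possible images — the input of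
READING R2 (abc-iut-c312-6's `Cor312Vol.statement_of_qRegion_subset_thetaHull`). [claim: Mochizuki2012, status: disputed] -/
theorem qRegion_subset_thetaHull_of_gluedMonoids_le
    (hρ : ∀ Φ ∈ Subgroup.closure (S.L.Ind1Family ∪ S.L.Ind2Family),
      ∀ (Ψ : ∀ v : T.V, v ∈ T.Vbad → Set (S.L.StarPacket v)) (j : T.Label) (vQ : T.VQ),
        ρ (fun v hv => S.L.starAut Φ v '' Ψ v hv) j vQ ⊆ Φ j vQ '' ρ Ψ j vQ)
    (hKumB : (S.col P.n).KummerB (S.D P.n))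
    (hb1 : ∀ (m : ℤ) (j : T.Label) (vQ : T.VQ), ρ ((S.col P.n).frobΨ m) j vQ ⊆ P.thetaRegion m j vQ)
    {D' : MRData S.L} (hD' : D' ∈ S.RLGP P.n)
    (hb2 : ∀ (j : T.Label) (vQ : T.VQ), P.qRegion j vQ ⊆ ρ D'.Ψ j vQ) (j : T.Label) (vQ : T.VQ) :
    P.qRegion j vQ ⊆ P.thetaHull j vQ := by
  obtain ⟨U, hU, hq⟩ := qRegion_subset_possibleImage_of_gluedMonoids_le S P ρ hρ hKumB hb1 hD' hb2 j vQ
  exact hq.trans ((Set.subset_sUnion_of_mem hU).trans ((P.frame j vQ).subset_hull _))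

/-- **Check (B), semi-form, from Theorem 3.11 AS TYPED: the printed Statement of Cor. 3.12 from CONTAINMENTS only.** With
`S.Statement` (supplying (ii)(b) and (i)'s `MultiradialCompat`), abc-iut-c312-6's `BridgeHyps`, a SEMI-equivariant region-forming
operator (hρ⊆), the lower bound (b1⊆) `ρ(Kummer image of the Frobenius-like splitting monoid of (n,m)) ⊆ Θ-region at (n,m)` — (Ind3)
free to enlarge — and the upper bound (b2⊆) `q-region ⊆ ρ(splitting monoid of the line-n′ datum)`, the printed Statement follows via
READING R2 (q-region ⊆ hull; monotonicity of the log-volume). This is the form in which every hypothesis is an "⊆", as in print's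
"upper semi-compatible" (p. 156). [claim: Mochizuki2012, status: disputed] -/
theorem statement_of_thm311_of_gluedMonoids_le (S : FullSituation T) (P : Cor312.Setting S.toLatticeSituation.toSituation)
    (ρ : (∀ v : T.V, v ∈ T.Vbad → Set (S.L.StarPacket v)) → ∀ (j : T.Label) (vQ : T.VQ), Set (S.L.Packet j vQ))
    (hThm : S.Statement) (H : BridgeHyps P)
    (hρ : ∀ Φ ∈ Subgroup.closure (S.L.Ind1Family ∪ S.L.Ind2Family),
      ∀ (Ψ : ∀ v : T.V, v ∈ T.Vbad → Set (S.L.StarPacket v)) (j : T.Label) (vQ : T.VQ),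
        ρ (fun v hv => S.L.starAut Φ v '' Ψ v hv) j vQ ⊆ Φ j vQ '' ρ Ψ j vQ)
    (hb1 : ∀ (m : ℤ) (j : T.Label) (vQ : T.VQ), ρ ((S.col P.n).frobΨ m) j vQ ⊆ P.thetaRegion m j vQ)
    (n' : ℤ) (hb2 : ∀ (j : T.Label) (vQ : T.VQ), P.qRegion j vQ ⊆ ρ (S.D n').Ψ j vQ) :
    P.Statement :=
  statement_of_qRegion_subset_thetaHull H fun i vQ =>
    qRegion_subset_thetaHull_of_gluedMonoids_le S.toLatticeSituation P ρ hρ (kummerB_of_statement S hThm P.n) hb1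
      (S.mem_RLGP_of_multiradialCompat (multiradialCompat_of_statement S hThm) P.n n') hb2 (Setting.labelSucc i) vQ

/-- The link-faithful instance of the semi-form: (b2⊆′) the q-region of column `n` lies in `ρ` of the Kummer image of the
Θ-splitting monoid of column `n − 1` at `(n−1, m₀)` (paraphrase of (xi-a) p. 181 l. 36–41, as a containment).
[claim: Mochizuki2012, status: disputed] -/
theorem statement_of_thm311_of_linkedColumn_le (S : FullSituation T) (P : Cor312.Setting S.toLatticeSituation.toSituation)
    (ρ : (∀ v : T.V, v ∈ T.Vbad → Set (S.L.StarPacket v)) → ∀ (j : T.Label) (vQ : T.VQ), Set (S.L.Packet j vQ))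
    (hThm : S.Statement) (H : BridgeHyps P)
    (hρ : ∀ Φ ∈ Subgroup.closure (S.L.Ind1Family ∪ S.L.Ind2Family),
      ∀ (Ψ : ∀ v : T.V, v ∈ T.Vbad → Set (S.L.StarPacket v)) (j : T.Label) (vQ : T.VQ),
        ρ (fun v hv => S.L.starAut Φ v '' Ψ v hv) j vQ ⊆ Φ j vQ '' ρ Ψ j vQ)
    (hb1 : ∀ (m : ℤ) (j : T.Label) (vQ : T.VQ), ρ ((S.col P.n).frobΨ m) j vQ ⊆ P.thetaRegion m j vQ)
    (m₀ : ℤ) (hb2 : ∀ (j : T.Label) (vQ : T.VQ), P.qRegion j vQ ⊆ ρ ((S.col (P.n - 1)).frobΨ m₀) j vQ) :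
    P.Statement := by
  have hΨ : (S.col (P.n - 1)).frobΨ m₀ = (S.D (P.n - 1)).Ψ :=
    funext fun v => funext fun hv => kummerB_of_statement S hThm (P.n - 1) m₀ v hv
  refine statement_of_thm311_of_gluedMonoids_le S P ρ hThm H hρ hb1 (P.n - 1) fun j vQ => ?_
  rw [← hΨ]
  exact hb2 j vQ

end Semi

end Summit.ABC.IUTFork.Cor312Vol.GluedMonoids

end
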